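import Summits.FinalStateConjecture.FinalStateConjecture.Theorems.ClusterCompletenessAdiabaticMultiKerrILEDRadialFieldWeightedGraph
import Summits.FinalStateConjecture.FinalStateConjecture.Theorems.ClusterCompletenessAdiabaticMultiKerrILEDRadialFieldDivergence
import Summits.FinalStateConjecture.FinalStateConjecture.Theorems.ClusterCompletenessAdiabaticMultiKerrILEDSmoothTransitionSlope

/-!
# Route ClusterCompleteness — crux `AdiabaticMultiKerrILED`, line `Sketch`:
# zeroth-order transport — the pointwise inequality of the transport field

Helper file for the crux `stmt-FinalStateConjecture-14310`
(`Summit.FinalStateConjecture.FinalStateConjecture.Theses.ClusterCompleteness.AdiabaticMultiKerrILED`),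
line `Sketch`, stub `zeroth_transport_pointwise` (lead c7, wave 8), the pointwise half of
`restFrame_zerothOrder_le` (file `…ZerothOrderTransport`).

Setting (zero spin, rest frame of the static tails-cut Schwarzschild zone, `r = Kerr.radius 0 = ‖x⃗‖`,
`χ = Real.smoothTransition`): the far cut-off `θ(r) = χ(6 − 2r/(3M))` (`= 1` for `r ≤ 15M/2`,
`= 0` for `r ≥ 9M`, `|θ'| ≤ 8/(3M)` by `abs_deriv_smoothTransition_le_four`), the TRANSPORT FUNCTION
`h = 2(r − 2M) θ(r) Φ²` of a `C¹` function `Φ`, and the purely spatial radial transport field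
`V = (0, h x⃗/‖x⃗‖)`, whose divergence is (`sum_fderiv_radialField`)
`div V = (2θ + 2(r−2M)θ')Φ² + 4(r−2M)θΦρ + 4(r−2M)θΦ²/r`, `ρ = x⃗·∇Φ/r`.

* `zeroth_transport_pointwise` — **the registered stub**, at a point with `r > 2M`: the pointwise
  transport inequality `θΦ² ≤ div V + 2(r−2M)|θ'|Φ² + 4θ((r−2M)ρ)²` (`zeroth_pointwise`:
  the difference is `θ(Φ + 2(r−2M)ρ)² + 2(r−2M)(θ' + |θ'|)Φ² + 4(r−2M)θΦ²/r ≥ 0`), the bounds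
  `2(r−2M)|θ'| ≤ 38 · 𝟙_{[15M/2, 9M]}`, `4θ((r−2M)S/r)² ≤ 648 M² (((1−μ)S/r + μT)² + T²) 𝟙_{r≤9M}`
  (`μ = χ(2 − r/8M) · 2H ≤ 2M/r` the tails-cut profile, so `(r−2M)/r ≤ 1 − μ`),
  `|h| ≤ 14MΦ² 𝟙_{r≤9M}`, the values of `θ` on the core and beyond `9M`, and the regularity of `h`
  (`C¹`) and of `div V` (continuous) there.

Dafermos–Rodnianski arXiv:0811.0354, §4.1.1 (zeroth-order terms generated by radial vector fields).
[folklore]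
-/

noncomputable section

-- the doubled `FinalStateConjecture.FinalStateConjecture` path component trips dupNamespace
set_option linter.dupNamespace false

open Set Filter
open scoped BigOperators Topology
open Literature.Geometry.Lorentzian

namespace Summit.FinalStateConjecture.FinalStateConjecture.Theorems

/-! ### Calculus of the far cut-off and of the transport field -/

/-- `χ = Real.smoothTransition` is differentiable, with derivative `χ'`. [folklore] -/
private theorem zeroth_hasDerivAt_smoothTransition (u : ℝ) :
    HasDerivAt Real.smoothTransition (deriv Real.smoothTransition u) u :=
  ((Real.smoothTransition.contDiffAt (n := 1)).differentiableAt (by simp)).hasDerivAt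

/-- `χ' = 0` off `[0, 1]`, where `χ` is locally constant. [folklore] -/
private theorem zeroth_deriv_smoothTransition_eq_zero {u : ℝ} (hu : u < 0 ∨ 1 < u) :
    deriv Real.smoothTransition u = 0 := by
  rcases hu with hu | hu
  · have h : Real.smoothTransition =ᶠ[𝓝 u] fun _ ↦ (0 : ℝ) := by
      filter_upwards [Iio_mem_nhds hu] with v hv
      exact Real.smoothTransition.zero_of_nonpos (le_of_lt hv)
    rw [h.deriv_eq, deriv_const]
  · have h : Real.smoothTransition =ᶠ[𝓝 u] fun _ ↦ (1 : ℝ) := by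
      filter_upwards [Ioi_mem_nhds hu] with v hv
      exact Real.smoothTransition.one_of_one_le (le_of_lt hv)
    rw [h.deriv_eq, deriv_const]

/-- The far cut-off `θ(ρ) = χ(6 − 2ρ/(3M))` (`= 1` for `ρ ≤ 15M/2`, `= 0` for `ρ ≥ 9M`) has
derivative `θ'(ρ) = χ'(6 − 2ρ/(3M)) · (−2/(3M))`. [folklore] -/
private theorem zeroth_hasDerivAt_cutoff (M ρ : ℝ) :
    HasDerivAt (fun ρ : ℝ ↦ Real.smoothTransition (6 - 2 * ρ / (3 * M)))
      (deriv Real.smoothTransition (6 - 2 * ρ / (3 * M)) * (-(2 / (3 * M)))) ρ := by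
  have h : HasDerivAt (fun ρ : ℝ ↦ 6 - 2 * ρ / (3 * M)) (-(2 / (3 * M))) ρ := by
    have h1 := (((hasDerivAt_id ρ).const_mul 2).div_const (3 * M)).const_sub 6
    simp only [id, mul_one] at h1
    exact h1
  exact (zeroth_hasDerivAt_smoothTransition _).comp ρ h

/-- The profile `g(ρ) = 2(ρ − 2M) θ(ρ)` of the transport function `h = g(r) Φ²` has derivative
`g'(ρ) = 2 θ(ρ) + 2(ρ − 2M) θ'(ρ)`. [folklore] -/
private theorem zeroth_hasDerivAt_profile (M ρ : ℝ) :
    HasDerivAt (fun ρ : ℝ ↦ 2 * (ρ - 2 * M) * Real.smoothTransition (6 - 2 * ρ / (3 * M)))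
      (2 * Real.smoothTransition (6 - 2 * ρ / (3 * M)) + 2 * (ρ - 2 * M) *
        (deriv Real.smoothTransition (6 - 2 * ρ / (3 * M)) * (-(2 / (3 * M))))) ρ := by
  have h1 : HasDerivAt (fun ρ : ℝ ↦ 2 * (ρ - 2 * M)) 2 ρ := by
    simpa using ((hasDerivAt_id ρ).sub_const (2 * M)).const_mul 2
  exact (h1.mul (zeroth_hasDerivAt_cutoff M ρ)).congr_deriv (by ring)

/-- **Divergence of the transport field** `V = (0, h x⃗/‖x⃗‖)` with `h = g(r) Φ²`: at a point with
`r = r(x) > 0` where `Φ` is differentiable and `g` has derivative `g'` at `r`,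
`∑_μ ∂_μ V^μ = g' Φ² + 2 g Φ (x⃗·∇Φ)/r + 2 g Φ²/r` (`sum_fderiv_radialField` with
`x⃗·∇h = g' r Φ² + 2 g Φ (x⃗·∇Φ)`). Dafermos–Rodnianski arXiv:0811.0354, §4.1.1. [folklore] -/
theorem zeroth_sum_fderiv_transportField {g : ℝ → ℝ} {g' r : ℝ} {Φ : E4 → ℝ} {x : E4}
    (hr : Kerr.radius 0 x = r) (h0 : 0 < r) (hg : HasDerivAt g g' r)
    (hΦ : DifferentiableAt ℝ Φ x) :
    ∑ μ, fderiv ℝ (fun z : E4 ↦ if μ = 0 then (0 : ℝ) else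
        g (Kerr.radius 0 z) * Φ z ^ 2 * z μ / E4.spatialNorm z) x (E4.basisVector μ) =
      g' * Φ x ^ 2 + 2 * g r * Φ x *
        (∑ i : Fin 3, x i.succ * fderiv ℝ Φ x (E4.basisVector i.succ)) / r +
        2 * (g r * Φ x ^ 2) / r := by
  have hxr : E4.spatialNorm x = r := by rw [← Kerr.radius_zero_left, hr]
  have hG := hardy_hasFDerivAt_comp_radius hr h0 hg
  have hGd : DifferentiableAt ℝ (fun z ↦ g (Kerr.radius 0 z)) x := hG.differentiableAt
  have hPd : DifferentiableAt ℝ (fun z ↦ Φ z ^ 2) x := hΦ.pow 2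
  have hcomp : ∀ i : Fin 3,
      fderiv ℝ (fun z ↦ g (Kerr.radius 0 z) * Φ z ^ 2) x (E4.basisVector i.succ) =
        g r * (2 * Φ x * fderiv ℝ Φ x (E4.basisVector i.succ)) +
          Φ x ^ 2 * (g' * r⁻¹ * x i.succ) := by
    intro i
    rw [fderiv_fun_mul hGd hPd, hG.fderiv, (hΦ.hasFDerivAt.pow 2).fderiv]
    fin_cases i <;> simp [hr]
  have hsq : x 1 ^ 2 + x 2 ^ 2 + x 3 ^ 2 = r ^ 2 := by rw [← E4.spatialNorm_sq, hxr]
  have hdiv := sum_fderiv_radialField (fun z ↦ g (Kerr.radius 0 z) * Φ z ^ 2) x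
    (by rw [hxr]; exact h0) (hGd.mul hPd)
  simp only [] at hdiv
  rw [hdiv, hxr, hr]
  simp only [hcomp, Fin.sum_univ_three, Fin.succ_zero_eq_one, Fin.succ_one_eq_two,
    Kerr.fin_succ_two_eq_three]
  have hr0 : r ≠ 0 := h0.ne'
  field_simp
  linear_combination (g' * Φ x ^ 2) * hsq

/-! ### The pointwise transport inequality and the bounds on its error terms -/

/-- **The pointwise transport inequality**: at a point with `r > 2M`, for `Φ` differentiable there,
`θ Φ² ≤ div V + 2(r − 2M)|θ'| Φ² + 4θ ((r − 2M)(x⃗·∇Φ)/r)²`, where `V = (0, h x⃗/‖x⃗‖)` is the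
transport field of `h = 2(r − 2M) θ(r) Φ²`: by `zeroth_sum_fderiv_transportField`,
`div V = (2θ + 2(r−2M)θ') Φ² + 4(r−2M)θ Φ ρ + 4(r−2M)θ Φ²/r` (`ρ = x⃗·∇Φ/r`), and
`div V + 2(r−2M)|θ'|Φ² + 4θ(r−2M)²ρ² − θΦ² = θ(Φ + 2(r−2M)ρ)² + 2(r−2M)(θ' + |θ'|)Φ² + 4(r−2M)θΦ²/r ≥ 0`.
Dafermos–Rodnianski arXiv:0811.0354, §4.1.1 (zeroth-order currents). [folklore] -/
theorem zeroth_pointwise {M : ℝ} (hM : 0 < M) {Φ : E4 → ℝ} {x : E4} (hΦ : DifferentiableAt ℝ Φ x)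
    (hx : 2 * M < Kerr.radius 0 x) :
    Real.smoothTransition (6 - 2 * Kerr.radius 0 x / (3 * M)) * Φ x ^ 2 ≤
      (∑ μ, fderiv ℝ (fun z : E4 ↦ if μ = 0 then (0 : ℝ) else
        2 * (Kerr.radius 0 z - 2 * M) * Real.smoothTransition (6 - 2 * Kerr.radius 0 z / (3 * M)) *
          Φ z ^ 2 * z μ / E4.spatialNorm z) x (E4.basisVector μ)) +
      2 * (Kerr.radius 0 x - 2 * M) *
        |deriv Real.smoothTransition (6 - 2 * Kerr.radius 0 x / (3 * M)) * (-(2 / (3 * M)))| *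
          Φ x ^ 2 +
      4 * Real.smoothTransition (6 - 2 * Kerr.radius 0 x / (3 * M)) *
        ((Kerr.radius 0 x - 2 * M) * (∑ i : Fin 3, x i.succ * fderiv ℝ Φ x (E4.basisVector i.succ)) /
          Kerr.radius 0 x) ^ 2 := by
  obtain ⟨r, hr⟩ : ∃ r, Kerr.radius 0 x = r := ⟨_, rfl⟩
  rw [hr] at hx ⊢
  have h0 : 0 < r := lt_trans (by positivity) hx
  have hdiv := zeroth_sum_fderiv_transportField
    (g := fun ρ : ℝ ↦ 2 * (ρ - 2 * M) * Real.smoothTransition (6 - 2 * ρ / (3 * M))) hr h0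
    (zeroth_hasDerivAt_profile M r) hΦ
  simp only [] at hdiv
  rw [hdiv]
  set θ := Real.smoothTransition (6 - 2 * r / (3 * M)) with hθ
  set θ' := deriv Real.smoothTransition (6 - 2 * r / (3 * M)) * (-(2 / (3 * M))) with hθ'
  set S := ∑ i : Fin 3, x i.succ * fderiv ℝ Φ x (E4.basisVector i.succ) with hS
  set ρ := (r - 2 * M) * S / r with hρ
  have hθ0 : 0 ≤ θ := Real.smoothTransition.nonneg _
  have hr2 : 0 ≤ r - 2 * M := by linarith
  have hSr : 2 * (2 * (r - 2 * M) * θ) * Φ x * S / r = 4 * θ * Φ x * ρ := by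
    rw [hρ]
    field_simp
    ring
  have h1 : 0 ≤ θ * (Φ x + 2 * ρ) ^ 2 := by positivity
  have h2 : 0 ≤ (r - 2 * M) * Φ x ^ 2 * (θ' + |θ'|) :=
    mul_nonneg (by positivity) (by linarith [neg_abs_le θ'])
  have h3 : 0 ≤ 2 * (2 * (r - 2 * M) * θ * Φ x ^ 2) / r := by positivity
  nlinarith [h1, h2, h3, hSr]

/-- **The cut-off vanishes beyond `9M`**: `θ(r) = χ(6 − 2r/(3M)) = 0` for `r ≥ 9M`. [folklore] -/
theorem zeroth_cutoff_eq_zero {M r : ℝ} (hM : 0 < M) (hr : 9 * M ≤ r) :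
    Real.smoothTransition (6 - 2 * r / (3 * M)) = 0 := by
  refine Real.smoothTransition.zero_of_nonpos ?_
  have : 6 ≤ 2 * r / (3 * M) := by
    rw [le_div_iff₀ (by positivity)]
    linarith
  linarith

/-- **The cut-off is `1` on the core**: `θ(r) = 1` for `r ≤ 15M/2`. [folklore] -/
theorem zeroth_cutoff_eq_one {M r : ℝ} (hM : 0 < M) (hr : r ≤ 15 * M / 2) :
    Real.smoothTransition (6 - 2 * r / (3 * M)) = 1 := by
  refine Real.smoothTransition.one_of_one_le ?_
  have : 2 * r / (3 * M) ≤ 5 := by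
    rw [div_le_iff₀ (by positivity)]
    linarith
  linarith

/-- **The cut-off error is supported in the far band**: `2(r − 2M)|θ'(r)| ≤ 38` for
`15M/2 ≤ r ≤ 9M` (`|χ'| ≤ 4`, `abs_deriv_smoothTransition_le_four`, `r − 2M ≤ 7M`) and
`θ'(r) = 0` off the band (`χ' = 0` off `[0, 1]`). [folklore] -/
theorem zeroth_cutoffDeriv_le {M : ℝ} (hM : 0 < M) (r : ℝ) :
    2 * (r - 2 * M) * |deriv Real.smoothTransition (6 - 2 * r / (3 * M)) * (-(2 / (3 * M)))| ≤
      if 15 * M / 2 ≤ r ∧ r ≤ 9 * M then 38 else 0 := by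
  split_ifs with hband
  · have h4 := abs_deriv_smoothTransition_le_four (6 - 2 * r / (3 * M))
    have hA : |deriv Real.smoothTransition (6 - 2 * r / (3 * M)) * (-(2 / (3 * M)))| ≤
        4 * (2 / (3 * M)) := by
      rw [abs_mul, abs_neg, abs_of_pos (by positivity : (0 : ℝ) < 2 / (3 * M))]
      exact mul_le_mul_of_nonneg_right h4 (by positivity)
    calc 2 * (r - 2 * M) * |deriv Real.smoothTransition (6 - 2 * r / (3 * M)) * (-(2 / (3 * M)))|
        ≤ 2 * (7 * M) * (4 * (2 / (3 * M))) :=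
          mul_le_mul (by linarith [hband.2]) hA (abs_nonneg _) (by positivity)
      _ = 112 / 3 := by
          field_simp
          ring
      _ ≤ 38 := by norm_num
  · have hz : deriv Real.smoothTransition (6 - 2 * r / (3 * M)) = 0 := by
      refine zeroth_deriv_smoothTransition_eq_zero ?_
      rcases not_and_or.mp hband with h | h
      · right
        rw [not_le] at h
        have : 2 * r / (3 * M) < 5 := by
          rw [div_lt_iff₀ (by positivity)]
          linarith
        linarith
      · left
        rw [not_le] at h
        have : 6 < 2 * r / (3 * M) := by
          rw [lt_div_iff₀ (by positivity)]
          linarith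
        linarith
    rw [hz, zero_mul, abs_zero, mul_zero]

/-- **The radial-derivative error in terms of `∂_{r*}Φ` and `∂₀Φ`**: on `2M < r ≤ 9M`,
`4θ((r − 2M) S/r)² ≤ 648 M² (((1 − μ) S/r + μ T)² + T²)` for all reals `S`, `T`
(`S = x⃗·∇Φ`, `T = ∂₀Φ`), where `μ = χ(2 − r/8M) · 2H ∈ [0, 2M/r]` is the tails-cut profile:
`(r − 2M)/r ≤ 1 − μ`, so `|(r−2M) S/r| ≤ r |(1−μ)S/r| = r |D − μT| ≤ 9M(|D| + |T|)`, and `θ ≤ 1`;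
for `r > 9M` the left side vanishes (`θ = 0`). [folklore] -/
theorem zeroth_radialTerm_le {M : ℝ} (hM : 0 < M) {x : E4} (hx : 2 * M < Kerr.radius 0 x)
    (S T : ℝ) :
    4 * Real.smoothTransition (6 - 2 * Kerr.radius 0 x / (3 * M)) *
        ((Kerr.radius 0 x - 2 * M) * S / Kerr.radius 0 x) ^ 2 ≤
      if Kerr.radius 0 x ≤ 9 * M then 648 * M ^ 2 *
        (((1 - Real.smoothTransition (2 - Kerr.radius 0 x / (8 * M)) * (2 * Kerr.scalarH M 0 x)) * S /
            Kerr.radius 0 x +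
          Real.smoothTransition (2 - Kerr.radius 0 x / (8 * M)) * (2 * Kerr.scalarH M 0 x) * T) ^ 2 +
          T ^ 2) else 0 := by
  rw [hardy_scalarH_zero]
  obtain ⟨r, hr⟩ : ∃ r, Kerr.radius 0 x = r := ⟨_, rfl⟩
  rw [hr] at hx ⊢
  have h0 : 0 < r := lt_trans (by positivity) hx
  have hθ0 : 0 ≤ Real.smoothTransition (6 - 2 * r / (3 * M)) := Real.smoothTransition.nonneg _
  have hθ1 : Real.smoothTransition (6 - 2 * r / (3 * M)) ≤ 1 := Real.smoothTransition.le_one _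
  split_ifs with h9
  · set χ := Real.smoothTransition (2 - r / (8 * M)) with hχ
    set m := χ * (2 * (M / r)) with hm
    have hχ0 : 0 ≤ χ := Real.smoothTransition.nonneg _
    have hχ1 : χ ≤ 1 := Real.smoothTransition.le_one _
    have hm0 : 0 ≤ m := by positivity
    have hm1 : m ≤ 2 * (M / r) := mul_le_of_le_one_left (by positivity) hχ1
    have hMr : 2 * (M / r) < 1 := by
      rw [← mul_div_assoc, div_lt_one h0]
      exact hx
    have hm1' : m ≤ 1 := by linarith
    set D := (1 - m) * S / r + m * T with hD
    -- `((r − 2M) S / r)² ≤ (1 − m)² S² = r² (D − m T)²`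
    have hf : (r - 2 * M) / r ≤ 1 - m := by
      have : (r - 2 * M) / r = 1 - 2 * (M / r) := by
        field_simp
      rw [this]
      linarith
    have hf0 : 0 ≤ (r - 2 * M) / r := div_nonneg (by linarith) h0.le
    have e1 : ((r - 2 * M) * S / r) ^ 2 = ((r - 2 * M) / r) ^ 2 * S ^ 2 := by
      field_simp
    have e2 : ((r - 2 * M) / r) ^ 2 * S ^ 2 ≤ (1 - m) ^ 2 * S ^ 2 :=
      mul_le_mul_of_nonneg_right (pow_le_pow_left₀ hf0 hf 2) (sq_nonneg _)
    have e3 : (1 - m) ^ 2 * S ^ 2 = r ^ 2 * (D - m * T) ^ 2 := by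
      rw [hD]
      field_simp
      ring
    have e4 : (D - m * T) ^ 2 ≤ 2 * (D ^ 2 + T ^ 2) := by
      have hmT : (m * T) ^ 2 ≤ T ^ 2 := by
        rw [mul_pow]
        exact mul_le_of_le_one_left (sq_nonneg _) (by nlinarith)
      nlinarith [sq_nonneg (D + m * T)]
    have e5 : r ^ 2 ≤ 81 * M ^ 2 := by nlinarith
    have hDT : 0 ≤ D ^ 2 + T ^ 2 := by positivity
    calc 4 * Real.smoothTransition (6 - 2 * r / (3 * M)) * ((r - 2 * M) * S / r) ^ 2
        ≤ 4 * 1 * ((r - 2 * M) * S / r) ^ 2 := by gcongr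
      _ ≤ 4 * (r ^ 2 * (2 * (D ^ 2 + T ^ 2))) := by
          rw [mul_one, e1]
          refine mul_le_mul_of_nonneg_left (e2.trans ?_) (by norm_num)
          rw [e3]
          exact mul_le_mul_of_nonneg_left e4 (sq_nonneg _)
      _ ≤ 4 * (81 * M ^ 2 * (2 * (D ^ 2 + T ^ 2))) := by gcongr
      _ = 648 * M ^ 2 * (D ^ 2 + T ^ 2) := by ring
  · rw [zeroth_cutoff_eq_zero hM (le_of_lt (not_le.mp h9)), mul_zero, zero_mul]

/-- **The transport function is dominated by `Φ²` on `{r ≤ 9M}`**: for `r > 2M`,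
`|h| = |2(r − 2M)θΦ²| ≤ 14 M Φ²` if `r ≤ 9M` and `h = 0` beyond. [folklore] -/
theorem zeroth_transportFn_abs_le {M : ℝ} (hM : 0 < M) {x : E4} (hx : 2 * M < Kerr.radius 0 x)
    (P : ℝ) :
    |2 * (Kerr.radius 0 x - 2 * M) * Real.smoothTransition (6 - 2 * Kerr.radius 0 x / (3 * M)) *
        P ^ 2| ≤ if Kerr.radius 0 x ≤ 9 * M then 14 * M * P ^ 2 else 0 := by
  have hθ0 := Real.smoothTransition.nonneg (6 - 2 * Kerr.radius 0 x / (3 * M))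
  have hθ1 := Real.smoothTransition.le_one (6 - 2 * Kerr.radius 0 x / (3 * M))
  rw [abs_of_nonneg (by nlinarith [sq_nonneg P, mul_nonneg (by linarith : (0:ℝ) ≤ 2 * (Kerr.radius 0 x - 2 * M)) hθ0])]
  split_ifs with h9
  · have hP := sq_nonneg P
    calc 2 * (Kerr.radius 0 x - 2 * M) * Real.smoothTransition (6 - 2 * Kerr.radius 0 x / (3 * M)) *
          P ^ 2 ≤ 2 * (7 * M) * 1 * P ^ 2 := by
          gcongr
          · linarith
      _ = 14 * M * P ^ 2 := by ring
  · rw [zeroth_cutoff_eq_zero hM (le_of_lt (not_le.mp h9)), mul_zero, zero_mul]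

/-! ### Regularity of the transport field -/

/-- **The transport function `h = 2(r − 2M) θ(r) Φ²` is `C¹` near every point off the time
axis** (`Φ ∈ C¹`; `r` is smooth where positive, `Kerr.contDiffAt_radius`). [folklore] -/
theorem zeroth_contDiffAt_transportFn {M : ℝ} {Φ : E4 → ℝ} (hΦ : ContDiff ℝ 1 Φ) {x : E4}
    (hx : 0 < Kerr.radius 0 x) :
    ContDiffAt ℝ 1 (fun z : E4 ↦ 2 * (Kerr.radius 0 z - 2 * M) *
      Real.smoothTransition (6 - 2 * Kerr.radius 0 z / (3 * M)) * Φ z ^ 2) x := by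
  have hr : ContDiffAt ℝ 1 (Kerr.radius 0) x := Kerr.contDiffAt_radius hx
  have hθ : ContDiffAt ℝ 1 (fun z ↦ Real.smoothTransition (6 - 2 * Kerr.radius 0 z / (3 * M))) x :=
    (Real.smoothTransition.contDiff (n := 1)).contDiffAt.comp x
      (contDiffAt_const.sub ((contDiffAt_const.mul hr).div_const (3 * M)))
  exact ((contDiffAt_const.mul (hr.sub contDiffAt_const)).mul hθ).mul (hΦ.contDiffAt.pow 2)

/-- **The divergence of the transport field is continuous at the points off the time axis**: each
component of `V = (0, h x⃗/‖x⃗‖)` is `C¹` there (`radialW_contDiffAt_radialField`), so its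
coordinate derivatives are continuous. [folklore] -/
theorem zeroth_continuousAt_divTransportField {M : ℝ} {Φ : E4 → ℝ} (hΦ : ContDiff ℝ 1 Φ)
    {x : E4} (hx : 0 < Kerr.radius 0 x) :
    ContinuousAt (fun x : E4 ↦ ∑ μ, fderiv ℝ (fun z : E4 ↦ if μ = 0 then (0 : ℝ) else
      2 * (Kerr.radius 0 z - 2 * M) * Real.smoothTransition (6 - 2 * Kerr.radius 0 z / (3 * M)) *
        Φ z ^ 2 * z μ / E4.spatialNorm z) x (E4.basisVector μ)) x := by
  have hx' : 0 < E4.spatialNorm x := by rwa [← Kerr.radius_zero_left]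
  refine tendsto_finsetSum _ fun μ _ ↦ ?_
  have hV := radialW_contDiffAt_radialField hx' (zeroth_contDiffAt_transportFn (M := M) hΦ hx) μ
  exact ((hV.fderiv_right (m := 0) le_rfl).clm_apply contDiffAt_const).continuousAt

/-! ### The registered stub -/

/-- **The pointwise facts of the zeroth-order transport argument** (crux
`stmt-FinalStateConjecture-14310`, line `Sketch`, stub `zeroth_transport_pointwise`): at a point
with `r > 2M`, for `Φ ∈ C¹` and `M > 0` — the transport inequality `zeroth_pointwise`, the error
bounds `zeroth_cutoffDeriv_le`, `zeroth_radialTerm_le`, `zeroth_transportFn_abs_le`, the values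
`θ = 1` on `r ≤ 15M/2` and `θ = 0` on `r ≥ 9M`, and the regularity of the transport function
(`C¹`) and of the divergence of the transport field (continuous). Dafermos–Rodnianski
arXiv:0811.0354, §4.1.1. [folklore] -/
theorem zeroth_transport_pointwise : ∀ (M : ℝ) (Φ : E4 → ℝ) (x : E4), 0 < M → ContDiff ℝ 1 Φ → 2 * M < Kerr.radius 0 x → (Real.smoothTransition (6 - 2 * Kerr.radius 0 x / (3 * M)) * Φ x ^ 2 ≤ (∑ μ, fderiv ℝ (fun z : E4 ↦ if μ = 0 then (0 : ℝ) else 2 * (Kerr.radius 0 z - 2 * M) * Real.smoothTransition (6 - 2 * Kerr.radius 0 z / (3 * M)) * Φ z ^ 2 * z μ / E4.spatialNorm z) x (E4.basisVector μ)) + 2 * (Kerr.radius 0 x - 2 * M) * |deriv Real.smoothTransition (6 - 2 * Kerr.radius 0 x / (3 * M)) * (-(2 / (3 * M)))| * Φ x ^ 2 + 4 * Real.smoothTransition (6 - 2 * Kerr.radius 0 x / (3 * M)) * ((Kerr.radius 0 x - 2 * M) * (∑ i : Fin 3, x i.succ * fderiv ℝ Φ x (E4.basisVector i.succ)) / Kerr.radius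 0 x) ^ 2) ∧ (2 * (Kerr.radius 0 x - 2 * M) * |deriv Real.smoothTransition (6 - 2 * Kerr.radius 0 x / (3 * M)) * (-(2 / (3 * M)))| ≤ if 15 * M / 2 ≤ Kerr.radius 0 x ∧ Kerr.radius 0 x ≤ 9 * M then (38 : ℝ) else 0) ∧ (∀ S T : ℝ, 4 * Real.smoothTransition (6 - 2 * Kerr.radius 0 x / (3 * M)) * ((Kerr.radius 0 x - 2 * M) * S / Kerr.radius 0 x) ^ 2 ≤ if Kerr.radius 0 x ≤ 9 * M then 648 * M ^ 2 * (((1 - Real.smoothTransition (2 - Kerr.radius 0 x / (8 * M)) * (2 * Kerr.scalarH M 0 x)) * S / Kerr.radius 0 x + Real.smoothTransition (2 - Kerr.radius 0 x / (8 * M)) * (2 * Kerr.scalarH M 0 x) * T) ^ 2 + T ^ 2) else 0) ∧ (|2 * (Kerr.radius 0 x - 2 * M) * Real.smoothTransition (6 - 2 * Kerr.radius 0 x / (3 * M)) * Φ x ^ 2| ≤ if Kerr.radius 0 x ≤ 9 * M then 14 * M * Φ x ^ 2 else 0) ∧ (Kerr.radius 0 x ≤ 15 * M / 2 → Real.smoothTransition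 (6 - 2 * Kerr.radius 0 x / (3 * M)) = 1) ∧ (9 * M ≤ Kerr.radius 0 x → Real.smoothTransition (6 - 2 * Kerr.radius 0 x / (3 * M)) = 0) ∧ ContDiffAt ℝ 1 (fun z : E4 ↦ 2 * (Kerr.radius 0 z - 2 * M) * Real.smoothTransition (6 - 2 * Kerr.radius 0 z / (3 * M)) * Φ z ^ 2) x ∧ ContinuousAt (fun x : E4 ↦ ∑ μ, fderiv ℝ (fun z : E4 ↦ if μ = 0 then (0 : ℝ) else 2 * (Kerr.radius 0 z - 2 * M) * Real.smoothTransition (6 - 2 * Kerr.radius 0 z / (3 * M)) * Φ z ^ 2 * z μ / E4.spatialNorm z) x (E4.basisVector μ)) x := by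
  intro M Φ x hM hΦ hx
  have h0 : 0 < Kerr.radius 0 x := lt_trans (by positivity) hx
  exact ⟨zeroth_pointwise hM (hΦ.differentiable one_ne_zero x) hx,
    zeroth_cutoffDeriv_le hM (Kerr.radius 0 x), fun S T ↦ zeroth_radialTerm_le hM hx S T,
    zeroth_transportFn_abs_le hM hx (Φ x), fun h ↦ zeroth_cutoff_eq_one hM h,
    fun h ↦ zeroth_cutoff_eq_zero hM h, zeroth_contDiffAt_transportFn hΦ h0,
    zeroth_continuousAt_divTransportField hΦ h0⟩

end Summit.FinalStateConjecture.FinalStateConjecture.Theorems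

end
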